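import Mathlib
import Literature.Analysis.FluidPDE.VectorCalculus

/-!
# `¬ CorrectorSolvable` (stmt-NavierStokesRegularity-1429), line `Sketch` — stub `correctorKill_zeroBall`

Route AdiabaticEddy, crux `Summit.NavierStokesRegularity.NavierStokesRegularity.Theses.AdiabaticEddy.CorrectorSolvable`.
The refutation reads the first-order corrector equation
(★) `(U·∇)W + (W·∇)U + ∇q = ΔU − aU + b(y·∇)U + (c·∇)U`
as a Stokes-type system for the pair `(U, q − const)` and kills it by unique continuation from an
OPEN ZERO SET. This file supplies that set: a compactly supported `U` on the non-compact space `ℝ³`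
vanishes on some ball `B(x₀, δ)` (take `x₀ ∉ tsupport U`, the complement of the closed set
`tsupport U` is open); on that ball `U` is locally zero, so `DU = 0` and `ΔU = 0`, every `U`-term of
(★) vanishes and (★) forces `∇q = 0`; by the mean value theorem on the (convex, open) ball, `q` is
constant there.  Only Mathlib calculus (`tsupport`, `Filter.EventuallyEq.fderiv_eq`,
`InnerProductSpace.laplacian_congr_nhds`, `IsOpen.is_const_of_fderiv_eq_zero`) is used.
-/

noncomputable section

-- the summit-side namespace `Summit.NavierStokesRegularity.NavierStokesRegularity.…` repeats a component by design (D-0017)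
set_option linter.dupNamespace false

namespace Summit.NavierStokesRegularity.NavierStokesRegularity.Theorems

open Set Metric InnerProductSpace

/-- **Stub E (an open zero set for `U` and `∇q`).** A compactly supported `U` on the non-compact space
`ℝ³` vanishes on some ball `B(x₀, δ)`; there every `U`-term of the corrector equation
(★) `(U·∇)W + (W·∇)U + ∇q = ΔU − aU + b(y·∇)U + (c·∇)U` vanishes (`DU = 0`, `ΔU = 0` on the open
zero set), so `∇q = 0` on the ball and `q` is constant on it (mean value theorem on a convex open
set). [folklore] -/
theorem correctorKill_zeroBall
    (U W : EuclideanSpace ℝ (Fin 3) → EuclideanSpace ℝ (Fin 3)) (q : EuclideanSpace ℝ (Fin 3) → ℝ)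
    (a b : ℝ) (c : EuclideanSpace ℝ (Fin 3)) (hq : ContDiff ℝ 1 q) (hUc : HasCompactSupport U)
    (hcorr : ∀ y, Literature.Analysis.FluidPDE.convect U W y +
      Literature.Analysis.FluidPDE.convect W U y + gradient q y =
      Laplacian.laplacian U y - a • U y + b • (fderiv ℝ U y) y + (fderiv ℝ U y) c) :
    ∃ x₀ : EuclideanSpace ℝ (Fin 3), ∃ δ : ℝ, 0 < δ ∧
      ∀ y ∈ Metric.ball x₀ δ, U y = 0 ∧ q y = q x₀ := by
  -- a point outside the (compact, hence proper) topological support of `U`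
  obtain ⟨x₀, hx₀⟩ : ∃ x₀ : EuclideanSpace ℝ (Fin 3), x₀ ∉ tsupport U :=
    (Set.ne_univ_iff_exists_notMem _).1 hUc.isCompact.ne_univ
  -- an open ball around it inside the open complement of the support
  obtain ⟨δ, hδ, hball⟩ :=
    Metric.isOpen_iff.1 (isClosed_tsupport U).isOpen_compl x₀ (Set.mem_compl hx₀)
  refine ⟨x₀, δ, hδ, ?_⟩
  -- `U` vanishes on the ball, and in fact near every point of the ball
  have hU0 : ∀ y ∈ Metric.ball x₀ δ, U y = 0 := fun y hy =>
    image_eq_zero_of_notMem_tsupport (hball hy)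
  have hUev : ∀ y ∈ Metric.ball x₀ δ,
      U =ᶠ[nhds y] fun _ => (0 : EuclideanSpace ℝ (Fin 3)) := fun y hy =>
    notMem_tsupport_iff_eventuallyEq.1 (hball hy)
  -- hence `DU = 0` and `ΔU = 0` on the ball
  have hDU : ∀ y ∈ Metric.ball x₀ δ, fderiv ℝ U y = 0 := fun y hy => by
    rw [(hUev y hy).fderiv_eq, fderiv_fun_const]
    rfl
  have hΔU : ∀ y ∈ Metric.ball x₀ δ, Laplacian.laplacian U y = 0 := fun y hy => by
    rw [(InnerProductSpace.laplacian_congr_nhds (hUev y hy)).eq_of_nhds,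
      InnerProductSpace.laplacian_const]
    rfl
  -- (★) on the ball reduces to `∇q = 0`, i.e. `Dq = 0`
  have hDq : (Metric.ball x₀ δ).EqOn (fderiv ℝ q) 0 := fun y hy => by
    have h := hcorr y
    simp only [Literature.Analysis.FluidPDE.convect_apply, hU0 y hy, hDU y hy, hΔU y hy, map_zero,
      zero_apply, smul_zero, zero_add, add_zero, sub_zero] at h
    simpa [gradient] using h
  -- mean value theorem on the convex open ball
  intro y hy
  exact ⟨hU0 y hy, Metric.isOpen_ball.is_const_of_fderiv_eq_zero (convex_ball x₀ δ).isPreconnected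
    (hq.differentiable one_ne_zero).differentiableOn hDq hy (Metric.mem_ball_self hδ)⟩

end Summit.NavierStokesRegularity.NavierStokesRegularity.Theorems

end
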